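import Summits.Ventures.YMGap.Thresholds.SharpClusteringFrame
import HarnessLib

/-!
# Venture YMGap — static exponential clustering, Part I-b:
# the weighted Bakry–Émery curvature bound on `SU(N)^E`

HONEST FRAMING: venture file (cell `pub-ymgap`, track (a), seat lit-1); continuation of
`SharpClusteringFrame`. No physics and no number in this file.

* `gradW`, `sum_sum_hessW_sym_eq` — the symmetric part of the weighted Hessian term is the second
  derivative `D_VD_VS` along `V = √w ∇u`;
* `hessBlock`, `sum_sum_coef_hess_eq` — block expansion of the Hessian term over pairs of links;
* `OffDiagHessBound` (termwise cross-link Hessian bounds `|D_{e,X}D_{e',Y}S| ≤ h_{ee'}‖X‖‖Y‖`,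
  Shen–Zhu–Zhu (4.3)) and `AdmissibleWeights` (positive weights, ratio `≤ ρ` across interacting links);
* `Gam2W_ge` — **the weighted curvature bound**: under `HessBound S Λ` (the GLOBAL quadratic-form
  constant), `OffDiagHessBound S h` with `h ≥ 0` symmetric and row sums `≤ H`, and admissible weights,
  `Γ₂^w(u) ≥ (N/2 - Λ - (√ρ - 1)H) Γ^w(u,u)` pointwise on `SU(N)^E`: the symmetric part costs `Λ`,
  only the weight asymmetry is paid termwise.

## References

* H. Shen, R. Zhu, X. Zhu, CMP 400 (2023) 805–851 = arXiv:2204.12737v1, Lemma 4.1, (4.3), (4.7).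
* B. Helffer, J. Funct. Anal. 155 (1998) 571–586 (method: Witten Laplacian with Combes–Thomas weights).
-/

noncomputable section

open scoped Matrix ComplexConjugate BigOperators Matrix.Norms.Frobenius ContDiff Topology
open Matrix Complex Finset MeasureTheory
open Literature.MathematicalPhysics.QuantumFieldTheory
open Literature.MathematicalPhysics.QuantumFieldTheory.SUNBakryEmery
  (FrameIdx frame frame_conjTranspose frame_trace frameGrad frameGrad_conjTranspose frameGrad_trace
   frobNorm_frameGrad_sq conjTranspose_comm_of_skew trace_comm)

namespace Summit.Ventures.YMGap

namespace SharpClustering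

open LatticeBakryEmery

universe u

variable {ι : Type u} [Fintype ι] [DecidableEq ι] {N : ℕ}

section Calculus

/-! ### The weighted gradient and the symmetric part of the Hessian term -/

/-- The **weighted gradient** `V = √w ∇u`: `∑_a √(w_a) D_au(Q) Y_a ∈ 𝔰𝔲(N)^E`. -/
def gradW (w : ι → ℝ) (u : Cfg ι N → ℝ) (Q : Cfg ι N) : Cfg ι N :=
  ∑ a : BIdx ι N, (Real.sqrt (w a.1) * algD (bframe a) u Q) • bframe a

/-- Components of the weighted gradient: `V_e = Z_{√w_e λ_e}`. -/
theorem gradW_apply (w : ι → ℝ) (u : Cfg ι N → ℝ) (Q : Cfg ι N) (e : ι) :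
    gradW w u Q e = frameGrad (Real.sqrt (w e) • linkFun u Q e) := by
  rw [gradW, Fintype.sum_prod_type, Finset.sum_apply, Finset.sum_eq_single e]
  · rw [frameGrad, Finset.sum_apply]
    refine sum_congr rfl fun α _ => ?_
    simp [bframe, lk, linkFun_apply]
  · intro e' _ he'
    rw [Finset.sum_apply]
    exact sum_eq_zero fun α _ => by simp [bframe, lk, he']
  · intro h; exact absurd (mem_univ _) h

/-- The weighted gradient is skew-Hermitian in every link. -/
theorem gradW_conjTranspose (w : ι → ℝ) (u : Cfg ι N → ℝ) (Q : Cfg ι N) (e : ι) :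
    (gradW w u Q e)ᴴ = -gradW w u Q e := by
  rw [gradW_apply]; exact frameGrad_conjTranspose _

/-- The weighted gradient is traceless in every link. -/
theorem gradW_trace (hN : N ≠ 0) (w : ι → ℝ) (u : Cfg ι N → ℝ) (Q : Cfg ι N) (e : ι) :
    (gradW w u Q e).trace = 0 := by
  rw [gradW_apply]; exact frameGrad_trace hN _

/-- `‖V‖² = Γ^w(u,u)`: `∑_e ‖V_e‖_F² = Γ^w(u,u)(Q)` for nonnegative weights. -/
theorem sum_frobNorm_gradW_sq (hN : N ≠ 0) {w : ι → ℝ} (hw : ∀ e, 0 ≤ w e) (u : Cfg ι N → ℝ) (Q : Cfg ι N) :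
    ∑ e, frobNorm (gradW w u Q e) ^ 2 = GamW w u u Q := by
  rw [GamW_self_eq_sum_sq, Fintype.sum_prod_type]
  refine sum_congr rfl fun e _ => ?_
  rw [gradW_apply, frobNorm_frameGrad_sq hN]
  refine sum_congr rfl fun α _ => ?_
  rw [LinearMap.smul_apply, linkFun_apply, smul_eq_mul, mul_pow, Real.sq_sqrt (hw e)]
  rfl

/-- **The symmetric part of the weighted Hessian term is a second derivative**:
`∑_{ab} √w_a √w_b D_au D_bu D_aD_bS(Q) = (D_V D_V S)(Q)`, `V = √w∇u(Q)` (bilinearity). -/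
theorem sum_sum_hessW_sym_eq (w : ι → ℝ) {S : Cfg ι N → ℝ} (hS : ContDiff ℝ ∞ S) (u : Cfg ι N → ℝ) (Q : Cfg ι N) :
    ∑ a : BIdx ι N, ∑ b : BIdx ι N,
        (Real.sqrt (w a.1) * algD (bframe a) u Q) * (Real.sqrt (w b.1) * algD (bframe b) u Q) *
          algD (bframe a) (algD (bframe b) S) Q =
      algD (gradW w u Q) (algD (gradW w u Q) S) Q := by
  set m : BIdx ι N → ℝ := fun a => Real.sqrt (w a.1) * algD (bframe a) u Q with hm
  have hV : gradW w u Q = ∑ b, m b • bframe b := rfl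
  have hinner : algD (gradW w u Q) S = fun P => ∑ b, m b * algD (bframe b) S P := by
    funext P; rw [hV]; exact algD_sum_smul_dir _ _ _ S P
  rw [hinner, algD_sum univ (F := fun b P => m b * algD (bframe b) S P)
    (fun b _ => contDiff_const.mul (contDiff_algD hS _))]
  simp only
  rw [sum_comm]
  refine sum_congr rfl fun b _ => ?_
  rw [algD_const_mul (contDiff_algD hS _), eq_comm]
  show m b * algD (gradW w u Q) (algD (bframe b) S) Q = _
  rw [hV, algD_sum_smul_dir, mul_sum]
  exact sum_congr rfl fun a _ => by simp only [hm]; ring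

/-! ### The cross-link part of the Hessian term -/

/-- The cross-link Hessian block of `S` at `Q` evaluated on the gradients of `u`:
`B_{ee'} = D_{single_e (∇u)_e} D_{single_{e'} (∇u)_{e'}} S (Q)`. -/
def hessBlock (S u : Cfg ι N → ℝ) (Q : Cfg ι N) (e e' : ι) : ℝ :=
  algD (lk e (grad u Q e)) (algD (lk e' (grad u Q e')) S) Q

/-- `single_e (∇u)_e = ∑_α D_{(e,α)}u · Y_{(e,α)}`. -/
theorem lk_grad_eq_sum (u : Cfg ι N → ℝ) (Q : Cfg ι N) (e : ι) :
    lk e (grad u Q e) = ∑ α : FrameIdx N, algD (bframe (e, α)) u Q • bframe (ι := ι) (e, α) := by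
  rw [grad_apply, frameGrad, lk_sum]
  refine sum_congr rfl fun α _ => ?_
  rw [lk_smul]
  simp [bframe, linkFun_apply, lk]

/-- **Block expansion of the Hessian term**: grouping the double frame sum by pairs of links,
`∑_{ab} c_{a.1 b.1} D_au D_bu D_aD_bS = ∑_{e,e'} c_{ee'} B_{ee'}` for any link coefficients `c`. -/
theorem sum_sum_coef_hess_eq (c : ι → ι → ℝ) {S : Cfg ι N → ℝ} (hS : ContDiff ℝ ∞ S) (u : Cfg ι N → ℝ)
    (Q : Cfg ι N) :
    ∑ a : BIdx ι N, ∑ b : BIdx ι N,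
        c a.1 b.1 * (algD (bframe a) u Q * algD (bframe b) u Q * algD (bframe a) (algD (bframe b) S) Q) =
      ∑ e : ι, ∑ e' : ι, c e e' * hessBlock S u Q e e' := by
  -- expand each block by bilinearity
  have hblock : ∀ e e' : ι, hessBlock S u Q e e' =
      ∑ α : FrameIdx N, ∑ β : FrameIdx N, algD (bframe (e, α)) u Q * algD (bframe (e', β)) u Q *
        algD (bframe (e, α)) (algD (bframe (e', β)) S) Q := by
    intro e e'
    rw [hessBlock, lk_grad_eq_sum, lk_grad_eq_sum]
    have hinner : algD (∑ β : FrameIdx N, algD (bframe (e', β)) u Q • bframe (ι := ι) (e', β)) S =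
        fun P => ∑ β, algD (bframe (e', β)) u Q * algD (bframe (e', β)) S P := by
      funext P; exact algD_sum_smul_dir _ _ _ S P
    rw [hinner, algD_sum_smul_dir]
    refine sum_congr rfl fun α _ => ?_
    rw [algD_sum univ (F := fun β P => algD (bframe (e', β)) u Q * algD (bframe (e', β)) S P)
      (fun β _ => contDiff_const.mul (contDiff_algD hS _))]
    simp only
    rw [mul_sum]
    refine sum_congr rfl fun β _ => ?_
    rw [algD_const_mul (contDiff_algD hS _)]
    ring
  simp_rw [hblock]
  simp only [Fintype.sum_prod_type]
  refine sum_congr rfl fun e _ => ?_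
  rw [sum_comm]
  refine sum_congr rfl fun e' _ => ?_
  rw [mul_sum]
  refine sum_congr rfl fun α _ => ?_
  rw [mul_sum]

/-! ### `Γ^w` through the link gradients -/

/-- `Γ^w(u,u)(Q) = ∑_e w_e ‖(∇u)_e‖_F²`. -/
theorem GamW_self_eq_sum_frobNorm_grad_sq (hN : N ≠ 0) (w : ι → ℝ) (u : Cfg ι N → ℝ) (Q : Cfg ι N) :
    GamW w u u Q = ∑ e, w e * frobNorm (grad u Q e) ^ 2 := by
  rw [GamW_self_eq_sum_sq, Fintype.sum_prod_type]
  refine sum_congr rfl fun e _ => ?_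
  rw [grad_apply, frobNorm_frameGrad_sq hN, mul_sum]
  rfl

/-! ### Hypothesis shapes: termwise cross-link Hessian bounds and admissible weights -/

/-- **Termwise bound on the cross-link Hessian blocks** of `S` on `SU(N)^E`:
`|D_{single_e X} D_{single_{e'} Y} S| ≤ h_{ee'} ‖X‖_F ‖Y‖_F` for `e ≠ e'` and `X, Y ∈ 𝔰𝔲(N)` (for the
Wilson action: `h_{ee'} = N|β| · #{plaquettes containing e and e'}`, Shen–Zhu–Zhu (4.3)). -/
def OffDiagHessBound (S : Cfg ι N → ℝ) (h : ι → ι → ℝ) : Prop :=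
  ∀ (g : PSU ι N) (e e' : ι), e ≠ e' → ∀ (X Y : Matrix (Fin N) (Fin N) ℂ),
    Xᴴ = -X → X.trace = 0 → Yᴴ = -Y → Y.trace = 0 →
      |algD (lk e X) (algD (lk e' Y) S) (emb g)| ≤ h e e' * frobNorm X * frobNorm Y

/-- **Admissible weights** for the interaction graph `h` with ratio `ρ`: positive, and two links that
interact (`h_{ee'} ≠ 0`) carry weights within a factor `ρ` of each other (for
`w_e = exp(2c·dist(e, Λ))` and a finite-range `h`, `ρ = e^{2c·range}`). -/
def AdmissibleWeights (h : ι → ι → ℝ) (ρ : ℝ) (w : ι → ℝ) : Prop :=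
  (∀ e, 0 < w e) ∧ ∀ e e', e ≠ e' → h e e' ≠ 0 → w e ≤ ρ * w e'

/-- The weight asymmetry across an interacting pair: if `a ≤ ρ b` and `b ≤ ρ a` (`a, b > 0`, `ρ ≥ 1`)
then `|a - √a√b| ≤ (√ρ - 1) √a √b`. -/
theorem abs_sub_sqrt_mul_sqrt_le {a b ρ : ℝ} (ha : 0 < a) (hb : 0 < b) (hρ : 1 ≤ ρ) (hab : a ≤ ρ * b)
    (hba : b ≤ ρ * a) : |a - Real.sqrt a * Real.sqrt b| ≤ (Real.sqrt ρ - 1) * Real.sqrt a * Real.sqrt b := by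
  have hρ0 : 0 ≤ ρ := le_trans zero_le_one hρ
  have hsa : 0 < Real.sqrt a := Real.sqrt_pos.2 ha
  have hsb : 0 < Real.sqrt b := Real.sqrt_pos.2 hb
  have hsρ : 1 ≤ Real.sqrt ρ := by rw [← Real.sqrt_one]; exact Real.sqrt_le_sqrt hρ
  have haa : Real.sqrt a * Real.sqrt a = a := Real.mul_self_sqrt ha.le
  have hbb : Real.sqrt b * Real.sqrt b = b := Real.mul_self_sqrt hb.le
  have h1 : Real.sqrt a ≤ Real.sqrt ρ * Real.sqrt b := by
    rw [← Real.sqrt_mul hρ0]; exact Real.sqrt_le_sqrt hab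
  have h2 : Real.sqrt b ≤ Real.sqrt ρ * Real.sqrt a := by
    rw [← Real.sqrt_mul hρ0]; exact Real.sqrt_le_sqrt hba
  have hkey : a - Real.sqrt a * Real.sqrt b = Real.sqrt a * (Real.sqrt a - Real.sqrt b) := by rw [mul_sub, haa]
  rw [hkey, abs_mul, abs_of_pos hsa]
  rcases le_total (Real.sqrt b) (Real.sqrt a) with hle | hle
  · rw [abs_of_nonneg (sub_nonneg.2 hle)]
    nlinarith
  · rw [abs_of_nonpos (sub_nonpos.2 hle)]
    nlinarith

/-! ### The weighted curvature bound -/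

/-- **Weighted Bakry–Émery curvature bound on `SU(N)^E`.** Let `S` be smooth with the global Hessian
bound `|D_VD_VS| ≤ Λ‖V‖²` on `SU(N)^E` (`HessBound S Λ`) and termwise cross-link bounds
`OffDiagHessBound S h` with `h ≥ 0` symmetric and row sums `≤ H`; let the weights `w` be admissible for
`h` with ratio `ρ ≥ 1`. Then for every smooth `u` and every `Q ∈ SU(N)^E`,
`Γ₂^w(u)(Q) ≥ (N/2 - Λ - (√ρ - 1)H) Γ^w(u,u)(Q)`. The symmetric part of the weighted Hessian term is
`D_VD_VS` at `V = √w∇u` and costs `Λ`; the antisymmetric remainder lives on interacting pairs of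
distinct links, where the weights differ by at most `ρ`, and costs `(√ρ - 1)H`. -/
theorem Gam2W_ge (hN : N ≠ 0) {S u : Cfg ι N → ℝ} (hS : ContDiff ℝ ∞ S) (hu : ContDiff ℝ ∞ u)
    {Λ H ρ : ℝ} {h : ι → ι → ℝ} {w : ι → ℝ} (hHess : HessBound S Λ) (hOff : OffDiagHessBound S h)
    (hh0 : ∀ e e', 0 ≤ h e e') (hsymm : ∀ e e', h e e' = h e' e) (hrow : ∀ e, ∑ e', h e e' ≤ H)
    (hρ : 1 ≤ ρ) (hw : AdmissibleWeights h ρ w) (g : PSU ι N) :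
    ((N : ℝ) / 2 - Λ - (Real.sqrt ρ - 1) * H) * GamW w u u (emb g) ≤ Gam2W w S u (emb g) := by
  set Q : Cfg ι N := emb g with hQ
  have hw0 : ∀ e, 0 ≤ w e := fun e => (hw.1 e).le
  have hwsq : ∀ e, Real.sqrt (w e) * Real.sqrt (w e) = w e := fun e => Real.mul_self_sqrt (hw0 e)
  -- the three pieces of the Bochner identity
  set A := ∑ a : BIdx ι N, ∑ b : BIdx ι N, w a.1 * algD (bframe b) (algD (bframe a) u) Q ^ 2 with hA
  set Tsym := ∑ a : BIdx ι N, ∑ b : BIdx ι N,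
      (Real.sqrt (w a.1) * algD (bframe a) u Q) * (Real.sqrt (w b.1) * algD (bframe b) u Q) *
        algD (bframe a) (algD (bframe b) S) Q with hTsym
  set c : ι → ι → ℝ := fun e e' => w e - Real.sqrt (w e) * Real.sqrt (w e') with hc
  set Tasym := ∑ a : BIdx ι N, ∑ b : BIdx ι N,
      c a.1 b.1 * (algD (bframe a) u Q * algD (bframe b) u Q * algD (bframe a) (algD (bframe b) S) Q) with hTasym
  have hsplit : Gam2W w S u Q = A - Tsym - Tasym := by
    rw [Gam2W_eq hN w hS hu Q, hA, hTsym, hTasym, sub_sub, ← sum_add_distrib]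
    congr 1
    refine sum_congr rfl fun a _ => ?_
    rw [← sum_add_distrib]
    refine sum_congr rfl fun b _ => ?_
    simp only [hc]
    ring
  -- Ricci
  have hRic : (N : ℝ) / 2 * GamW w u u Q ≤ A := ricci_GamW_le hN hw0 hu Q
  -- symmetric Hessian part
  have hSym : |Tsym| ≤ Λ * GamW w u u Q := by
    rw [hTsym, sum_sum_hessW_sym_eq w hS u Q, ← sum_frobNorm_gradW_sq hN hw0 u Q]
    exact hHess g (gradW w u Q) (gradW_conjTranspose w u Q) (gradW_trace hN w u Q)
  -- antisymmetric part
  have hAsym : |Tasym| ≤ (Real.sqrt ρ - 1) * H * GamW w u u Q := by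
    rw [hTasym, sum_sum_coef_hess_eq c hS u Q]
    set n : ι → ℝ := fun e => frobNorm (grad u Q e) with hn
    have hn0 : ∀ e, 0 ≤ n e := fun e => frobNorm_nonneg _
    -- termwise
    have hterm : ∀ e e' : ι, |c e e' * hessBlock S u Q e e'| ≤
        (Real.sqrt ρ - 1) / 2 * h e e' * (w e * n e ^ 2 + w e' * n e' ^ 2) := by
      intro e e'
      have hρ1 : 0 ≤ Real.sqrt ρ - 1 := by
        rw [sub_nonneg, ← Real.sqrt_one]; exact Real.sqrt_le_sqrt hρ
      have hR : 0 ≤ (Real.sqrt ρ - 1) / 2 * h e e' * (w e * n e ^ 2 + w e' * n e' ^ 2) :=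
        mul_nonneg (mul_nonneg (by linarith) (hh0 e e')) (by nlinarith [hw0 e, hw0 e', hn0 e, hn0 e'])
      by_cases hee : e = e'
      · subst hee
        have : c e e = 0 := by simp only [hc, hwsq, sub_self]
        rw [this, zero_mul, abs_zero]
        exact hR
      have hB : |hessBlock S u Q e e'| ≤ h e e' * n e * n e' := by
        rw [hessBlock, hQ]
        exact hOff g e e' hee _ _ (grad_conjTranspose u _ e) (grad_trace hN u _ e)
          (grad_conjTranspose u _ e') (grad_trace hN u _ e')
      by_cases hh : h e e' = 0
      · have hB0 : hessBlock S u Q e e' = 0 := by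
          rw [hh, zero_mul, zero_mul] at hB
          exact abs_eq_zero.1 (le_antisymm hB (abs_nonneg _))
        rw [hB0, mul_zero, abs_zero]
        exact hR
      · have h12 : w e ≤ ρ * w e' := hw.2 e e' hee hh
        have h21 : w e' ≤ ρ * w e := hw.2 e' e (Ne.symm hee) (by rwa [hsymm e' e])
        have hcb : |c e e'| ≤ (Real.sqrt ρ - 1) * Real.sqrt (w e) * Real.sqrt (w e') :=
          abs_sub_sqrt_mul_sqrt_le (hw.1 e) (hw.1 e') hρ h12 h21
        rw [abs_mul]
        have hprod : |c e e'| * |hessBlock S u Q e e'| ≤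
            ((Real.sqrt ρ - 1) * Real.sqrt (w e) * Real.sqrt (w e')) * (h e e' * n e * n e') :=
          mul_le_mul hcb hB (abs_nonneg _) (by positivity)
        refine hprod.trans ?_
        -- `2 √w_e n_e √w_e' n_e' ≤ w_e n_e² + w_e' n_e'²`
        have hsq : 2 * (Real.sqrt (w e) * n e) * (Real.sqrt (w e') * n e') ≤ w e * n e ^ 2 + w e' * n e' ^ 2 := by
          have h0 := sq_nonneg (Real.sqrt (w e) * n e - Real.sqrt (w e') * n e')
          nlinarith [hwsq e, hwsq e']
        have hhρ : 0 ≤ (Real.sqrt ρ - 1) * h e e' := mul_nonneg hρ1 (hh0 e e')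
        nlinarith
    -- sum the termwise bounds
    calc |∑ e, ∑ e', c e e' * hessBlock S u Q e e'|
        ≤ ∑ e, |∑ e', c e e' * hessBlock S u Q e e'| := abs_sum_le_sum_abs _ _
      _ ≤ ∑ e, ∑ e', |c e e' * hessBlock S u Q e e'| := sum_le_sum fun e _ => abs_sum_le_sum_abs _ _
      _ ≤ ∑ e, ∑ e', (Real.sqrt ρ - 1) / 2 * h e e' * (w e * n e ^ 2 + w e' * n e' ^ 2) :=
          sum_le_sum fun e _ => sum_le_sum fun e' _ => hterm e e'
      _ = (Real.sqrt ρ - 1) / 2 * (∑ e, (∑ e', h e e') * (w e * n e ^ 2)) +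
          (Real.sqrt ρ - 1) / 2 * (∑ e', (∑ e, h e e') * (w e' * n e' ^ 2)) := by
          have hL : ∑ e, ∑ e', (Real.sqrt ρ - 1) / 2 * h e e' * (w e * n e ^ 2 + w e' * n e' ^ 2) =
              ∑ e, ∑ e', (Real.sqrt ρ - 1) / 2 * h e e' * (w e * n e ^ 2) +
                ∑ e, ∑ e', (Real.sqrt ρ - 1) / 2 * h e e' * (w e' * n e' ^ 2) := by
            rw [← sum_add_distrib]
            refine sum_congr rfl fun e _ => ?_
            rw [← sum_add_distrib]
            exact sum_congr rfl fun e' _ => by ring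
          rw [hL, sum_comm (f := fun e e' => (Real.sqrt ρ - 1) / 2 * h e e' * (w e' * n e' ^ 2))]
          congr 1
          · rw [mul_sum]
            refine sum_congr rfl fun e _ => ?_
            rw [sum_mul, mul_sum]
            exact sum_congr rfl fun e' _ => by ring
          · rw [mul_sum]
            refine sum_congr rfl fun e' _ => ?_
            rw [sum_mul, mul_sum]
            exact sum_congr rfl fun e _ => by ring
      _ ≤ (Real.sqrt ρ - 1) / 2 * (H * GamW w u u Q) + (Real.sqrt ρ - 1) / 2 * (H * GamW w u u Q) := by
          have hρ1 : 0 ≤ (Real.sqrt ρ - 1) / 2 := by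
            have : 0 ≤ Real.sqrt ρ - 1 := by rw [sub_nonneg, ← Real.sqrt_one]; exact Real.sqrt_le_sqrt hρ
            linarith
          have hG : GamW w u u Q = ∑ e, w e * n e ^ 2 := GamW_self_eq_sum_frobNorm_grad_sq hN w u Q
          have hcol : ∀ e', ∑ e, h e e' ≤ H := fun e' => by
            rw [show ∑ e, h e e' = ∑ e, h e' e from sum_congr rfl fun e _ => hsymm e e']; exact hrow e'
          have i1 : ∑ e, (∑ e', h e e') * (w e * n e ^ 2) ≤ H * GamW w u u Q := by
            rw [hG, mul_sum]
            exact sum_le_sum fun e _ => mul_le_mul_of_nonneg_right (hrow e) (mul_nonneg (hw0 e) (sq_nonneg _))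
          have i2 : ∑ e', (∑ e, h e e') * (w e' * n e' ^ 2) ≤ H * GamW w u u Q := by
            rw [hG, mul_sum]
            exact sum_le_sum fun e' _ => mul_le_mul_of_nonneg_right (hcol e') (mul_nonneg (hw0 e') (sq_nonneg _))
          exact add_le_add (mul_le_mul_of_nonneg_left i1 hρ1) (mul_le_mul_of_nonneg_left i2 hρ1)
      _ = (Real.sqrt ρ - 1) * H * GamW w u u Q := by ring
  -- assemble
  rw [hsplit]
  have h1 := (abs_le.1 hSym).2
  have h2 := (abs_le.1 hAsym).2
  nlinarith [hRic, h1, h2, GamW_self_nonneg hw0 u Q]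

end Calculus

end SharpClustering

end Summit.Ventures.YMGap
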